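import Literature.NumberTheory.GelbartRogawski1991.CMSplittingCharArchComponents
import Literature.NumberTheory.Automorphic.UnitaryGroupArchToAdelicPlaces
import HarnessLib

/-!
# Kudla's `x(p) = det(p|_Δ)` at the archimedean element `(g, 1)`: finite part, place components, idelic modulus
([Kudla1994, §3]; [HarrisKudlaSweet1996, §1 (1.11)–(1.12)]: the character `χ(x(p)) |x(p)|^{1/2}` of the Siegel
parabolic; archimedean places of the kernel construction of [GelbartRogawski1991, Prop. 3.1.1])

Topic `NumberTheory/GelbartRogawski1991`; namespace `Literature.NumberTheory.GelbartRogawski1991.UnitaryDualPair.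
ArchSplitting`.  KERNEL only: proved bookkeeping theorems; no new notion, no named fact, no `sorry`.

For `g ∈ U(J)(E ⊗ ℝ)` (`J ∈ M_{n+n}(E)` arbitrary) let `M` be the adelic matrix of `(g, 1) = archToAdelic g` and
`x((g,1)) = det((e₂⁻¹ M e₂)₁₁ + (e₂⁻¹ M e₂)₁₂) ∈ 𝔸_E` (`e₂ = finSumFinEquiv`; on the Siegel parabolic of the diagonal
`Δ` this is Kudla's `x(p) = det(p|_Δ)`, the tree's `detDelta`):

* `snd_det_deltaBlock_archToAdelic` — the finite part of `x((g,1))` is `1`;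
* `extensionEmbedding_fst_det_deltaBlock_archToAdelic` — at a complex place `w` fixed by `c`:
  `σ_w(x((g,1))_w) = x(g_w)`, `g_w = archAt w g ∈ U(σ_w J)(ℂ)`;
* (CM field `L`, `wOf : {v real place of L⁺} → {w ∣ v}`) `ideleNorm_infiniteIdeles_eq_prod_norm_sq` —
  `|(y, 1)|_{𝔸_L} = ∏_v ‖σ_{w(v)}(y_{w(v)})‖²`; hence **`ideleNorm_eq_prod_norm_det_deltaBlock_sq`** — for an idele `u`
  of `L` with `u = x((g,1))`: `|u|_{𝔸_L} = ∏_v ‖x(g_{w(v)})‖²` — the MODULUS half `|x(p)|_{𝔸_L} = ∏_w |det α_w|²_ℂ`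
  of the Siegel-parabolic character at the archimedean element (companion of the CHARACTER half
  `DoubledUnitaryArchSiegelTwist`).

Written for the stage-1 cell `pub-hodgecm`, seat GR-3 (`stub_S1arch_modulus` ∕ `stub_S1arch_twist` of the [GR91 3.1.1]
kernel construction); nothing here is a claim of the manuscripts adjudicated by that cell.

## References

* S. S. Kudla, Israel J. Math. 87 (1994) 361–401, §3 [Kudla1994].
* M. Harris, S. S. Kudla, W. J. Sweet, J. Amer. Math. Soc. 9 (1996), §1 (1.11)–(1.12) [HarrisKudlaSweet1996].
* A. Borel, H. Jacquet, PSPM 33.1 (1979), §4.1 [BorelJacquet1979].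
* J. Tate, *Fourier analysis in number fields and Hecke's zeta-functions* (1950/1967), §4.3 (the idelic modulus)
  [TateThesis1967].
-/

set_option autoImplicit false

noncomputable section

open NumberField NumberField.InfinitePlace
open scoped MatrixGroups Classical

open _root_.Literature.NumberTheory.Automorphic _root_.Literature.NumberTheory.Automorphic.UnitaryGroup
open _root_.Literature.NumberTheory.GaloisRepresentations

namespace Literature.NumberTheory.GelbartRogawski1991.UnitaryDualPair.ArchSplitting

/-! ## § 7 `x((g, 1))`: finite part and place components (any `E/F`, `c`, `J`) -/

section AnyField

variable {R S : Type*} [CommRing R] [CommRing S] {n : ℕ}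

/-- `f (x(M)) = x(f(M))` for a ring homomorphism `f` (Kudla's `x` is a polynomial functional of the matrix).
[cite: Kudla1994, §3] -/
private theorem map_det_deltaBlock (f : R →+* S) (M : Matrix (Fin (n + n)) (Fin (n + n)) R) :
    f ((Matrix.reindex finSumFinEquiv.symm finSumFinEquiv.symm M).toBlocks₁₁ +
        (Matrix.reindex finSumFinEquiv.symm finSumFinEquiv.symm M).toBlocks₁₂).det =
      ((Matrix.reindex finSumFinEquiv.symm finSumFinEquiv.symm (M.map f)).toBlocks₁₁ +
        (Matrix.reindex finSumFinEquiv.symm finSumFinEquiv.symm (M.map f)).toBlocks₁₂).det := by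
  have h : ((Matrix.reindex finSumFinEquiv.symm finSumFinEquiv.symm M).toBlocks₁₁ +
        (Matrix.reindex finSumFinEquiv.symm finSumFinEquiv.symm M).toBlocks₁₂).map f =
      (Matrix.reindex finSumFinEquiv.symm finSumFinEquiv.symm (M.map f)).toBlocks₁₁ +
        (Matrix.reindex finSumFinEquiv.symm finSumFinEquiv.symm (M.map f)).toBlocks₁₂ := by
    rw [Matrix.map_add f (map_add f)]; rfl
  rw [RingHom.map_det, RingHom.mapMatrix_apply, h]

/-- `x(1) = 1`. [cite: Kudla1994, §3] -/
private theorem det_deltaBlock_one :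
    ((Matrix.reindex finSumFinEquiv.symm finSumFinEquiv.symm (1 : Matrix (Fin (n + n)) (Fin (n + n)) R)).toBlocks₁₁ +
        (Matrix.reindex finSumFinEquiv.symm finSumFinEquiv.symm
          (1 : Matrix (Fin (n + n)) (Fin (n + n)) R)).toBlocks₁₂).det = 1 := by
  rw [Matrix.reindex_apply, Matrix.submatrix_one_equiv, ← Matrix.fromBlocks_one, Matrix.toBlocks_fromBlocks₁₁,
    Matrix.toBlocks_fromBlocks₁₂, add_zero, Matrix.det_one]

variable (F E : Type) [Field F] [NumberField F] [Field E] [NumberField E] [Algebra F E]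
  (c : E ≃ₐ[F] E) (J : Matrix (Fin (n + n)) (Fin (n + n)) E)

/-- **the finite part of `x((g,1))` is `1`** (`(g,1)_f = 1`). [cite: Kudla1994, §3] [cite: BorelJacquet1979, §4.1] -/
theorem snd_det_deltaBlock_archToAdelic (g : arch F E c (n + n) J) :
    (((Matrix.reindex finSumFinEquiv.symm finSumFinEquiv.symm
          (((archToAdelic F E c (n + n) J g).1 : GL (Fin (n + n)) (AdeleRing (𝓞 E) E)) :
            Matrix (Fin (n + n)) (Fin (n + n)) (AdeleRing (𝓞 E) E))).toBlocks₁₁ +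
        (Matrix.reindex finSumFinEquiv.symm finSumFinEquiv.symm
          (((archToAdelic F E c (n + n) J g).1 : GL (Fin (n + n)) (AdeleRing (𝓞 E) E)) :
            Matrix (Fin (n + n)) (Fin (n + n)) (AdeleRing (𝓞 E) E))).toBlocks₁₂).det).2 = 1 := by
  have h := map_det_deltaBlock (adeleSnd E)
    (((archToAdelic F E c (n + n) J g).1 : GL (Fin (n + n)) (AdeleRing (𝓞 E) E)) :
      Matrix (Fin (n + n)) (Fin (n + n)) (AdeleRing (𝓞 E) E))
  rw [map_snd_coe_archToAdelic, det_deltaBlock_one] at h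
  exact h

/-- **`σ_w(x((g,1))_w) = x(g_w)`** at a complex place `w` fixed by `c ≠ 1`: the `w`-coordinate of Kudla's `x` of the
archimedean element is `x` of the place component `g_w = archAt w g`. [cite: Kudla1994, §3] [cite: BorelJacquet1979, §4.1] -/
theorem extensionEmbedding_fst_det_deltaBlock_archToAdelic (w : {w : InfinitePlace E // w.IsComplex})
    (hw : c • w.1 = w.1) (hc : c ≠ 1) (g : arch F E c (n + n) J) :
    Completion.extensionEmbedding w.1
        ((((Matrix.reindex finSumFinEquiv.symm finSumFinEquiv.symm
              (((archToAdelic F E c (n + n) J g).1 : GL (Fin (n + n)) (AdeleRing (𝓞 E) E)) :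
                Matrix (Fin (n + n)) (Fin (n + n)) (AdeleRing (𝓞 E) E))).toBlocks₁₁ +
            (Matrix.reindex finSumFinEquiv.symm finSumFinEquiv.symm
              (((archToAdelic F E c (n + n) J g).1 : GL (Fin (n + n)) (AdeleRing (𝓞 E) E)) :
                Matrix (Fin (n + n)) (Fin (n + n)) (AdeleRing (𝓞 E) E))).toBlocks₁₂).det).1 w.1) =
      ((Matrix.reindex finSumFinEquiv.symm finSumFinEquiv.symm
            (((archAt F E c (n + n) J w hw hc g : archLocal E (n + n) J w) : GL (Fin (n + n)) ℂ) :
              Matrix (Fin (n + n)) (Fin (n + n)) ℂ)).toBlocks₁₁ +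
          (Matrix.reindex finSumFinEquiv.symm finSumFinEquiv.symm
            (((archAt F E c (n + n) J w hw hc g : archLocal E (n + n) J w) : GL (Fin (n + n)) ℂ) :
              Matrix (Fin (n + n)) (Fin (n + n)) ℂ)).toBlocks₁₂).det := by
  have h := map_det_deltaBlock ((Completion.extensionEmbedding w.1).comp
      ((Pi.evalRingHom (fun v : InfinitePlace E => v.Completion) w.1).comp (adeleFst E)))
    (((archToAdelic F E c (n + n) J g).1 : GL (Fin (n + n)) (AdeleRing (𝓞 E) E)) :
      Matrix (Fin (n + n)) (Fin (n + n)) (AdeleRing (𝓞 E) E))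
  rw [map_placeEval_coe_archToAdelic F E c (n + n) J w hw hc g] at h
  exact h

end AnyField

/-! ## § 8 The idelic modulus of `x((g, 1))` over a CM field -/

section CM

variable (L : Type) [Field L] [NumberField L] [IsCMField L] {n : ℕ}
  (J : Matrix (Fin (n + n)) (Fin (n + n)) L) (hc : IsCMField.complexConj L ≠ 1)
  (wOf : {v : InfinitePlace (maximalRealSubfield L) // v.IsReal} → {w : InfinitePlace L // w.IsComplex})
  (hw : ∀ v, IsCMField.complexConj L • (wOf v).1 = (wOf v).1)
  (hover : ∀ v, (wOf v).1.comap (algebraMap (maximalRealSubfield L) L) = v.1)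

include hover in
/-- **`|(y, 1)|_{𝔸_L} = ∏_v ‖σ_{w(v)}(y_{w(v)})‖²`**: the idelic modulus of an infinite idele of the CM field `L`,
indexed by the real places of `L⁺` (all places of `L` are complex, local degree `2`; `σ_w` is an isometry).
[cite: TateThesis1967, §4.3] -/
theorem ideleNorm_infiniteIdeles_eq_prod_norm_sq (y : (InfiniteAdeleRing L)ˣ) :
    ideleNorm (infiniteIdeles L y) =
      ∏ v : {v : InfinitePlace (maximalRealSubfield L) // v.IsReal},
        ‖Completion.extensionEmbedding (wOf v).1 ((y : InfiniteAdeleRing L) (wOf v).1)‖ ^ 2 := by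
  unfold ideleNorm
  have h2 : ((infiniteIdeles L y : ideleGroup L) : AdeleRing (𝓞 L) L).2 = 1 := rfl
  have h3 : ∀ v : IsDedekindDomain.HeightOneSpectrum (𝓞 L),
      (1 : IsDedekindDomain.FiniteAdeleRing (𝓞 L) L) v = 1 := fun v => rfl
  rw [h2, finprod_eq_one_of_forall_eq_one fun v => by rw [h3 v, norm_one], mul_one,
    prod_infinitePlace_eq_prod_wOf L wOf hover]
  refine Finset.prod_congr rfl fun v _ => ?_
  rw [mult_isComplex, (Completion.isometry_extensionEmbedding (wOf v).1).norm_map_of_map_zero (map_zero _)]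
  rfl

include hover in
/-- **The modulus of Kudla's `x` at the archimedean element: `|x((g,1))|_{𝔸_L} = ∏_v ‖x(g_{w(v)})‖²`** for every
idele `u` of `L` equal to `x((g,1))` (`g ∈ U(J)(L ⊗ ℝ)`, `J ∈ M_{n+n}(L)` arbitrary) — the modulus half
`|x(p)|^{1/2}_{𝔸_L} = ∏_w |det α_w|_ℂ^{1/2·2}` of the Siegel-parabolic character `χ(x(p))|x(p)|^{1/2}` at the
archimedean places. [cite: Kudla1994, §3] [cite: HarrisKudlaSweet1996, §1 (1.11)–(1.12)] -/
theorem ideleNorm_eq_prod_norm_det_deltaBlock_sq (g : arch (maximalRealSubfield L) L (IsCMField.complexConj L) (n + n) J)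
    (u : ideleGroup L)
    (hu : ((u : ideleGroup L) : AdeleRing (𝓞 L) L) =
      ((Matrix.reindex finSumFinEquiv.symm finSumFinEquiv.symm
            (((archToAdelic (maximalRealSubfield L) L (IsCMField.complexConj L) (n + n) J g).1 :
              GL (Fin (n + n)) (AdeleRing (𝓞 L) L)) : Matrix (Fin (n + n)) (Fin (n + n)) (AdeleRing (𝓞 L) L))).toBlocks₁₁ +
          (Matrix.reindex finSumFinEquiv.symm finSumFinEquiv.symm
            (((archToAdelic (maximalRealSubfield L) L (IsCMField.complexConj L) (n + n) J g).1 :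
              GL (Fin (n + n)) (AdeleRing (𝓞 L) L)) : Matrix (Fin (n + n)) (Fin (n + n)) (AdeleRing (𝓞 L) L))).toBlocks₁₂).det) :
    ideleNorm u =
      ∏ v : {v : InfinitePlace (maximalRealSubfield L) // v.IsReal},
        ‖((Matrix.reindex finSumFinEquiv.symm finSumFinEquiv.symm
              (((archAt (maximalRealSubfield L) L (IsCMField.complexConj L) (n + n) J (wOf v) (hw v) hc g :
                archLocal L (n + n) J (wOf v)) : GL (Fin (n + n)) ℂ) : Matrix (Fin (n + n)) (Fin (n + n)) ℂ)).toBlocks₁₁ +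
            (Matrix.reindex finSumFinEquiv.symm finSumFinEquiv.symm
              (((archAt (maximalRealSubfield L) L (IsCMField.complexConj L) (n + n) J (wOf v) (hw v) hc g :
                archLocal L (n + n) J (wOf v)) : GL (Fin (n + n)) ℂ) : Matrix (Fin (n + n)) (Fin (n + n)) ℂ)).toBlocks₁₂).det‖ ^ 2 := by
  -- `u = (y, 1)` with `y = u_∞`
  let y : (InfiniteAdeleRing L)ˣ := Units.map (adeleFst L : AdeleRing (𝓞 L) L →* InfiniteAdeleRing L) u
  have hyu : infiniteIdeles L y = u := by
    apply Units.ext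
    change ((((u : ideleGroup L) : AdeleRing (𝓞 L) L).1, (1 : IsDedekindDomain.FiniteAdeleRing (𝓞 L) L)) :
      AdeleRing (𝓞 L) L) = _
    rw [hu]
    exact Prod.ext rfl (snd_det_deltaBlock_archToAdelic (maximalRealSubfield L) L (IsCMField.complexConj L) J g).symm
  rw [← hyu, ideleNorm_infiniteIdeles_eq_prod_norm_sq L wOf hover y]
  refine Finset.prod_congr rfl fun v _ => ?_
  rw [← extensionEmbedding_fst_det_deltaBlock_archToAdelic (maximalRealSubfield L) L (IsCMField.complexConj L) J
    (wOf v) (hw v) hc g]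
  change ‖Completion.extensionEmbedding (wOf v).1 ((((u : ideleGroup L) : AdeleRing (𝓞 L) L)).1 (wOf v).1)‖ ^ 2 = _
  rw [hu]

end CM

end Literature.NumberTheory.GelbartRogawski1991.UnitaryDualPair.ArchSplitting

end
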